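import Summits.AtomisticToContinuum.Crystallization.Theorems.ExcessDecayLiouvillePhononStabilityCertStilde

/-!
# Near-certificate layer V5-c2b: curvature dominators of the class model terms over a box (lead c2, vertex scheme)

Support file for crux `PhononStability` (stmt-AtomisticToContinuum-9333), line `contragredient-window-collapse`.

With the enclosure `stildeIvl` of the second-derivative matrix of a class model term over a box (layer V5-c2a), this
file transforms to a fixed rational frame `U` (first column the reference bond direction, so that the dominant rank-one
`ω̃″ ẑẑᵀ` part is diagonal there), takes the diagonal absolute-row-sum dominator `D` (`curvDiag`, `curvD`) and returns
`W = U⁻ᵀ diag(D) U⁻¹` (`curvW`).  Results: `stilde_le_curvW` (on the box the second-derivative matrix is `⪯ W`),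
`curvW_psd`, and the concavity of `t ↦ classModel(y[v ↦ t]) − P_c(W)(w)/2 · t²` on the slice (`concaveOn_classModel`)
— the per-class input of the vertex interpolation lemma.  Inclusion monotonicity of `curvD` is layer V5-c3.
-/

noncomputable section

open scoped BigOperators
open Set Function
open Summit.AtomisticToContinuum.Crystallization.Theorems.PhononStabilityNegative

namespace Summit.AtomisticToContinuum.Crystallization.Theorems.PhononStabilityCWC.Cert

local notation "E3" => EuclideanSpace ℝ (Fin 3)

/-! ## The frame dominator `W = U⁻ᵀ diag(D) U⁻¹` -/

/-- the enclosure of the frame-transformed entry `S′_ab = Σ_ij U_ia S_ij U_jb` -/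
def frameIvl (U : Mat) (S : Fin 3 → Fin 3 → Ivl) (a b : Fin 3) : Ivl :=
  (List.finRange 3).foldr (fun i acc => (List.finRange 3).foldr (fun j acc' =>
    Ivl.add (Ivl.smul (U i a * U j b) (S i j)) acc') acc) (Ivl.const 0)

/-- the real frame-transformed entry -/
def frameR (U : Mat) (S : Fin 3 → Fin 3 → ℝ) (a b : Fin 3) : ℝ := ∑ i, ∑ j, (U i a : ℝ) * (U j b : ℝ) * S i j

/-- soundness of the inner fold of `frameIvl`. [folklore] -/
theorem mem_frameIvl_inner (U : Mat) {S : Fin 3 → Fin 3 → Ivl} {Sr : Fin 3 → Fin 3 → ℝ}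
    (h : ∀ i j, (S i j).mem (Sr i j)) (a b i : Fin 3) {acc : Ivl} {r : ℝ} (hacc : acc.mem r) (l : List (Fin 3)) :
    (l.foldr (fun j acc' => Ivl.add (Ivl.smul (U i a * U j b) (S i j)) acc') acc).mem
      ((l.map fun j => (U i a : ℝ) * (U j b : ℝ) * Sr i j).sum + r) := by
  induction l with
  | nil => simpa using hacc
  | cons j l ih =>
      simp only [List.foldr_cons, List.map_cons, List.sum_cons]
      have h1 : (Ivl.smul (U i a * U j b) (S i j)).mem ((U i a : ℝ) * (U j b : ℝ) * Sr i j) := by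
        have := Ivl.mem_smul (U i a * U j b) (h i j); push_cast at this; simpa [mul_assoc] using this
      have := Ivl.mem_add h1 ih
      simpa [add_assoc] using this

/-- soundness of `frameIvl`. [folklore] -/
theorem mem_frameIvl (U : Mat) {S : Fin 3 → Fin 3 → Ivl} {Sr : Fin 3 → Fin 3 → ℝ} (h : ∀ i j, (S i j).mem (Sr i j))
    (a b : Fin 3) : (frameIvl U S a b).mem (frameR U Sr a b) := by
  unfold frameIvl frameR
  have key : ∀ (l : List (Fin 3)), ((l.foldr (fun i acc => (List.finRange 3).foldr (fun j acc' =>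
      Ivl.add (Ivl.smul (U i a * U j b) (S i j)) acc') acc) (Ivl.const 0))).mem
      ((l.map fun i => ∑ j, (U i a : ℝ) * (U j b : ℝ) * Sr i j).sum) := by
    intro l
    induction l with
    | nil => simpa using Ivl.mem_const 0
    | cons i l ih =>
        simp only [List.foldr_cons, List.map_cons, List.sum_cons]
        have := mem_frameIvl_inner U h a b i ih (List.finRange 3)
        rw [← List.ofFn_eq_map, List.sum_ofFn] at this
        exact this
  have := key (List.finRange 3)
  rw [← List.ofFn_eq_map, List.sum_ofFn] at this
  exact this

/-- **the diagonal dominator** `D_a = max 0 (hi S′_aa + Σ_{b ≠ a} (mag S′_ab + mag S′_ba)/2)` -/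
def curvDiag (S' : Fin 3 → Fin 3 → Ivl) (a : Fin 3) : ℚ :=
  max 0 ((S' a a).hi + ∑ b ∈ Finset.univ.erase a, (Ivl.mag (S' a b) + Ivl.mag (S' b a)) / 2)

/-- **diagonal domination of a real bilinear form by entry bounds.** [folklore] -/
theorem frame_quad_le {S' : Fin 3 → Fin 3 → Ivl} {Sr' : Fin 3 → Fin 3 → ℝ} (h : ∀ a b, (S' a b).mem (Sr' a b))
    (z : Fin 3 → ℝ) : ∑ a, ∑ b, Sr' a b * z a * z b ≤ ∑ a, (curvDiag S' a : ℝ) * z a ^ 2 := by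
  -- off-diagonal terms: `S_ab z_a z_b ≤ |S_ab| (z_a² + z_b²)/2`
  have hoff : ∀ a b, Sr' a b * z a * z b ≤ (Ivl.mag (S' a b) : ℝ) * (z a ^ 2 + z b ^ 2) / 2 := by
    intro a b
    have hm : |Sr' a b| ≤ Ivl.mag (S' a b) := Ivl.abs_le_mag (h a b)
    have h1 : Sr' a b * z a * z b ≤ |Sr' a b| * |z a * z b| := by
      rw [mul_assoc]; exact (le_abs_self _).trans_eq (abs_mul _ _)
    have h2 : |z a * z b| ≤ (z a ^ 2 + z b ^ 2) / 2 := by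
      rw [abs_le]; constructor <;> nlinarith [sq_nonneg (z a + z b), sq_nonneg (z a - z b)]
    have h3 : |Sr' a b| * |z a * z b| ≤ (Ivl.mag (S' a b) : ℝ) * ((z a ^ 2 + z b ^ 2) / 2) :=
      mul_le_mul hm h2 (abs_nonneg _) ((abs_nonneg _).trans hm)
    linarith
  have hdiag : ∀ a, Sr' a a * z a * z a ≤ ((S' a a).hi : ℝ) * z a ^ 2 := by
    intro a
    have := (h a a).2
    have hz : 0 ≤ z a ^ 2 := sq_nonneg _
    nlinarith
  -- sum the bounds and rearrange
  have hsplit : ∀ a, ∑ b, Sr' a b * z a * z b ≤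
      ((S' a a).hi : ℝ) * z a ^ 2 + ∑ b ∈ Finset.univ.erase a, (Ivl.mag (S' a b) : ℝ) * (z a ^ 2 + z b ^ 2) / 2 := by
    intro a
    rw [← Finset.add_sum_erase _ _ (Finset.mem_univ a)]
    exact add_le_add (hdiag a) (Finset.sum_le_sum fun b _ => hoff a b)
  calc ∑ a, ∑ b, Sr' a b * z a * z b
      ≤ ∑ a, (((S' a a).hi : ℝ) * z a ^ 2 + ∑ b ∈ Finset.univ.erase a, (Ivl.mag (S' a b) : ℝ) * (z a ^ 2 + z b ^ 2) / 2) :=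
        Finset.sum_le_sum fun a _ => hsplit a
    _ = ∑ a, (((S' a a).hi : ℝ) + ∑ b ∈ Finset.univ.erase a, ((Ivl.mag (S' a b) : ℝ) + Ivl.mag (S' b a)) / 2) * z a ^ 2 := by
        simp only [Fin.sum_univ_three, Finset.sum_erase_eq_sub (Finset.mem_univ _), Fin.isValue]
        ring
    _ ≤ ∑ a, (curvDiag S' a : ℝ) * z a ^ 2 := by
        refine Finset.sum_le_sum fun a _ => mul_le_mul_of_nonneg_right ?_ (sq_nonneg _)
        unfold curvDiag; push_cast
        exact le_max_right _ _

/-- **the curvature dominator data of a (class, variable) over a box:** the three diagonal entries in the frame `U` -/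
def curvD (ρbar : ℚ) (P : SPoly) (Z Λ : List (Mono × Mat)) (v : ℕ) (U : Mat) (B : Box) (a : Fin 3) : ℚ :=
  curvDiag (frameIvl U (stildeIvl ρbar P Z Λ v B)) a

/-- **the curvature dominator** `W = U⁻ᵀ diag(D) U⁻¹` (rational symmetric PSD matrix) -/
def curvW (D : Fin 3 → ℚ) (Uinv : Mat) : Mat := fun i j => ∑ a, Uinv a i * D a * Uinv a j

/-- the quadratic form of `curvW` is `Σ_a D_a (U⁻¹u)_a²`. [folklore] -/
theorem bilR_curvW (D : Fin 3 → ℚ) (Uinv : Mat) (u : Fin 3 → ℝ) :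
    bilR (fun i j => (curvW D Uinv i j : ℝ)) u u = ∑ a, (D a : ℝ) * (∑ i, (Uinv a i : ℝ) * u i) ^ 2 := by
  simp only [bilR, curvW, Fin.sum_univ_three]
  push_cast
  ring

/-- `curvW` is positive semidefinite for nonnegative `D`. [folklore] -/
theorem curvW_psd {D : Fin 3 → ℚ} (hD : ∀ a, 0 ≤ D a) (Uinv : Mat) (u : Fin 3 → ℝ) :
    0 ≤ bilR (fun i j => (curvW D Uinv i j : ℝ)) u u := by
  rw [bilR_curvW]
  exact Finset.sum_nonneg fun a _ => mul_nonneg (by exact_mod_cast hD a) (sq_nonneg _)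

/-- `curvD ≥ 0`. [folklore] -/
theorem curvD_nonneg (ρbar : ℚ) (P : SPoly) (Z Λ : List (Mono × Mat)) (v : ℕ) (U : Mat) (B : Box) (a : Fin 3) :
    0 ≤ curvD ρbar P Z Λ v U B a := le_max_left _ _

/-- change of variables in a real bilinear form: `u = U a` gives `uᵀ S u = aᵀ (Uᵀ S U) a`. [folklore] -/
theorem bilR_frame (U : Mat) (S : Fin 3 → Fin 3 → ℝ) (z : Fin 3 → ℝ) :
    bilR S (fun i => ∑ a, (U i a : ℝ) * z a) (fun i => ∑ a, (U i a : ℝ) * z a) = ∑ a, ∑ b, frameR U S a b * z a * z b := by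
  simp only [bilR, frameR, Fin.sum_univ_three]
  ring

/-- `U (U⁻¹ u) = u` from `U U⁻¹ = 1`. [folklore] -/
theorem frame_apply_inv {U Uinv : Mat} (hU : matEqB (mmul U Uinv) oneQ = true) (u : Fin 3 → ℝ) (i : Fin 3) :
    ∑ a, (U i a : ℝ) * (∑ j, (Uinv a j : ℝ) * u j) = u i := by
  have h := eq_of_matEqB hU
  have hij : ∀ j, ∑ a, (U i a : ℝ) * (Uinv a j : ℝ) = if i = j then 1 else 0 := by
    intro j
    have h1 := congrFun (congrFun h i) j
    simp only [mmul, oneQ] at h1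
    have h2 := congrArg (fun q : ℚ => (q : ℝ)) h1
    push_cast at h2
    rw [h2]
    split <;> simp
  calc ∑ a, (U i a : ℝ) * (∑ j, (Uinv a j : ℝ) * u j) = ∑ j, (∑ a, (U i a : ℝ) * (Uinv a j : ℝ)) * u j := by
        simp only [Fin.sum_univ_three]; ring
    _ = u i := by simp only [hij, Fin.sum_univ_three]; fin_cases i <;> simp

/-- **DOMINATION: on the box, the second-derivative matrix of the class model term is `⪯ W`.** [folklore] -/
theorem stilde_le_curvW (ρbar : ℚ) (P : SPoly) (Z Λ : List (Mono × Mat)) (v : ℕ) {U Uinv : Mat}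
    (hU : matEqB (mmul U Uinv) oneQ = true) {B : Box} (hpos : 0 < (rhoIvl ρbar P B).lo) {y : ℕ → ℝ} (hy : B.mem y) :
    MatLE (stilde ρbar P Z Λ v y) (fun i j => (curvW (curvD ρbar P Z Λ v U B) Uinv i j : ℝ)) := by
  intro u
  set z : Fin 3 → ℝ := fun a => ∑ j, (Uinv a j : ℝ) * u j with hz
  have hu : u = fun i => ∑ a, (U i a : ℝ) * z a := by
    funext i; exact (frame_apply_inv hU u i).symm
  rw [bilR_curvW]
  conv_lhs => rw [hu]
  rw [bilR_frame]
  have hmem : ∀ a b, (frameIvl U (stildeIvl ρbar P Z Λ v B) a b).mem (frameR U (stilde ρbar P Z Λ v y) a b) :=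
    fun a b => mem_frameIvl U (fun i j => mem_stildeIvl ρbar P Z Λ v hpos hy i j) a b
  exact frame_quad_le hmem z

/-! ## Concavity of the class model term along a slice, modulo `P_c(W)(w)/2 · t²` -/

/-- **PER-CLASS INPUT OF THE VERTEX LEMMA:** on a box whose `ρ`-interval is positive, along the slice of `v` through any
point of the box, `t ↦ classModel(x[v ↦ t])(w) − P_c(W)(w)/2 · t²` is concave on the slice interval. [folklore] -/
theorem concaveOn_classModel {w : Label → E3} (hw : (support w).Finite) (ρbar : ℚ) {P : SPoly} {Z Λ : List (Mono × Mat)}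
    (c : BondClass) {v : ℕ} (hP : spDegLe P v 2 = true) (hZ : mpDegLe Z v 2 = true) (hΛ : mpDegLe Λ v 2 = true)
    {U Uinv : Mat} (hU : matEqB (mmul U Uinv) oneQ = true) {B : Box} (hpos : 0 < (rhoIvl ρbar P B).lo)
    {x : ℕ → ℝ} (hx : B.mem x) :
    ConcaveOn ℝ (Icc ((B v).lo : ℝ) ((B v).hi : ℝ)) (fun t => classModel ρbar P Z Λ c (update x v t) w
      - pairEvalR c (fun i j => (curvW (curvD ρbar P Z Λ v U B) Uinv i j : ℝ)) w / 2 * t ^ 2) := by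
  have hmemt : ∀ t ∈ Icc ((B v).lo : ℝ) ((B v).hi : ℝ), B.mem (update x v t) := by
    intro t ht k
    by_cases hk : k = v
    · subst hk; rw [update_self]; exact ⟨ht.1, ht.2⟩
    · rw [update_of_ne hk]; exact hx k
  have hfun : (fun t => classModel ρbar P Z Λ c (update x v t) w
      - pairEvalR c (fun i j => (curvW (curvD ρbar P Z Λ v U B) Uinv i j : ℝ)) w / 2 * t ^ 2)
      = fun t => sliceSum [sliceOmega ρbar P Z c v x w, slicePsi ρbar P Λ c v x w] 0 0 0 t
        - pairEvalR c (fun i j => (curvW (curvD ρbar P Z Λ v U B) Uinv i j : ℝ)) w / 2 * t ^ 2 := by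
    funext t
    rw [classModel_update hw ρbar c hP hZ hΛ x t]
    simp [sliceSum]
  rw [hfun]
  refine concaveOn_sliceSum ?_ 0 0 0 ?_ ?_
  · intro s hs
    simp only [List.mem_cons, List.mem_nil_iff, or_false] at hs
    rcases hs with rfl | rfl
    · exact sliceOmega_derivOK ρbar P Z c v x w
    · exact slicePsi_derivOK ρbar P Λ c v x w
  · -- positivity of `ρ(t)` on the slice: it lies in the positive `ρ`-interval
    intro t ht s hs
    have hρt : ∀ s' : SliceTerm, s'.r0 = (ρbar : ℝ) + spEval (spCoeff P v 0) x → s'.r1 = spEval (spCoeff P v 1) x →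
        s'.r2 = spEval (spCoeff P v 2) x → 0 < s'.rho t := by
      intro s' h0 h1 h2
      have heq : s'.rho t = (ρbar : ℝ) + spEval P (update x v t) := by
        rw [SliceTerm.rho, spEval_update P v hP, h0, h1, h2]; ring
      rw [heq]
      have hm := mem_rhoIvl ρbar P (hmemt t ht)
      have : (0 : ℝ) < (rhoIvl ρbar P B).lo := by exact_mod_cast hpos
      exact lt_of_lt_of_le this hm.1
    simp only [List.mem_cons, List.mem_nil_iff, or_false] at hs
    rcases hs with rfl | rfl
    · exact hρt _ rfl rfl rfl
    · exact hρt _ rfl rfl rfl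
  · intro t ht
    refine classSlice_g2_le hw ρbar P Z Λ c v x ?_ t ht
    intro t' ht' u
    have h := stilde_le_curvW ρbar P Z Λ v hU hpos (hmemt t' ht') u
    have heq : ∀ i j, g2Mat (sliceOmega ρbar P Z c v x w) (matVal x (mpCoeff Z v 0)) (matVal x (mpCoeff Z v 1))
          (matVal x (mpCoeff Z v 2)) t' i j
        + g2Mat (slicePsi ρbar P Λ c v x w) (matVal x (mpCoeff Λ v 0)) (matVal x (mpCoeff Λ v 1))
          (matVal x (mpCoeff Λ v 2)) t' i j = stilde ρbar P Z Λ v (update x v t') i j :=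
      fun i j => g2_sum_eq_stilde ρbar c hP hZ hΛ x w t' i j
    have hb : bilR (fun i j => g2Mat (sliceOmega ρbar P Z c v x w) (matVal x (mpCoeff Z v 0)) (matVal x (mpCoeff Z v 1))
          (matVal x (mpCoeff Z v 2)) t' i j
        + g2Mat (slicePsi ρbar P Λ c v x w) (matVal x (mpCoeff Λ v 0)) (matVal x (mpCoeff Λ v 1))
          (matVal x (mpCoeff Λ v 2)) t' i j) u u = bilR (stilde ρbar P Z Λ v (update x v t')) u u := by
      simp only [bilR, heq]
    rw [hb]
    exact h

/-- Anchor of this support file (registered stub of the line skeleton, lead c2): the formal derivative of the zero polynomial. -/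
theorem stub_certCurv : spD [] 1 = [] := by
  rfl

end Summit.AtomisticToContinuum.Crystallization.Theorems.PhononStabilityCWC.Cert

end
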